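import Literature.NumberTheory.Automorphic.QuadraticCharacterTwist
import Literature.NumberTheory.GaloisRepresentations.SorensenPatchingHypotheses
import Literature.NumberTheory.GaloisRepresentations.FrobeniusPlaces
import Literature.NumberTheory.GaloisRepresentations.FrobeniusDensityTheorem
import Literature.NumberTheory.GaloisRepresentations.InducedGaloisRep
import Literature.NumberTheory.GaloisRepresentations.FramedRepBlockSum
import Literature.NumberTheory.GaloisRepresentations.RestrictFieldSemisimple
import Mathlib.NumberTheory.NumberField.CMField
import HarnessLib

/-!
# The Galois side of the quadratic descent of an induced representation: compositum, diamond,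
# the block sum `(Ind_E^K W)|Γ_{E'}` and the matching of an irreducible block (Schur)

Topic `NumberTheory/GaloisRepresentations`.  PROOF FILE (theorems only: no definition, no named fact,
no instance).  For a quadratic Galois extension `E/K` of number fields, a Galois `K'/K` and the compositum
`E' = E K'`, these are the pieces of elementary Galois theory and linear algebra through which the
automorphy of `Ind_E^K W|Γ_{K'}` (potential automorphy over a totally real field, Barnet-Lamb–Gee–
Geraghty–Taylor Thm. C) is descended to `W|Γ_{E'}` along Arthur–Clozel's Thm. 4.2 (b) (crux
`stmt-Langlands-17000` of the summit `Langlands`, line `symmetrise-pd-split`, stub 3'):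

* `exists_quadratic_compositum` — the compositum `E' = E K'` AS A TYPE, for `E/K` quadratic with `E`
  totally complex and `K'` totally real: a number field with compatible algebra structures, `[E' : K'] = 2`,
  totally complex, generated by the images of `E` and `K'` (`E' = K'(φ a)` in `\overline{K'}` for a
  primitive element `a` of `E/K`; `[E' : K'] ≠ 1` because `E` does not embed into `K'`);
* `exists_signChar_absGaloisRestrict` — the quadratic character `η_{E/K} : Γ_K → Aˣ` (`1` on `res(Γ_E)`,
  `-1` off it) with values in any topological ring with `2 ≠ 0`;
* `mem_range_absGaloisRestrict_iff_of_compositum` — the diamond: `g ∈ Γ_{K'}` comes from `Γ_{E'}` iff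
  `res g ∈ Γ_K` comes from `Γ_E` (`Γ_{E'} = Γ_E ∩ Γ_{K'}`,
  `SorensenPatching.range_absGaloisRestrict_eq_inf_of_sup_eq_top`);
  `not_mem_range_absGaloisRestrict_of_inert` — at a place inert in a quadratic extension no Frobenius
  comes from the subgroup (`exists_places_split_of_mem_range`);
* `finrank_le_two_mul_of_index_two` — for `π` irreducible and `N` of index two, a non-zero `N`-stable
  subspace has `dim V ≤ 2 dim U` (the even half of Clifford's theorem, as in
  `Representation.isIrreducible_comp_of_index_two`);
* block sums of framed representations: transport of subrepresentations along a change of frame and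
  into `ρ₁ ⊞ ρ₂` (`exists_subrepresentation_conj`, `exists_subrepresentation_blockSum_left/right`),
  Schur's lemma for framed representations (`isUnit_of_mul_eq_mul_of_isIrreducible`) and the MATCHING OF
  AN IRREDUCIBLE BLOCK: `T₀ ⊞ T₁ = S (U₀ ⊞ U₁) S⁻¹` with `U_j` irreducible forces `U_j ≅ T₀` or `U_j ≅ T₁`
  (`exists_eq_conj_of_blockSum_eq_conj_blockSum`, `…'`);
* `induce_restrictField_restrictField_eq_blockSum` — `((Ind_E^K W)|Γ_E)|Γ_{E'}` is the block sum of the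
  restrictions of the two conjugates `W^{rᵢ⁻¹}` (`induce_restrictField_apply_coe`), one of which is a
  change of frame of `W` (`exists_absGaloisCosetRep_mem_range`, `outerConj_inv_restrictField_eq_conj`).

## References

* A. H. Clifford, *Representations induced in an invariant subgroup*, Ann. of Math. 38 (1937), Thm. 1.
  [Clifford1937]
* J.-P. Serre, *Linear representations of finite groups*, GTM 42, §2.2 Prop. 4 (Schur), §7.3 Prop. 22.
  [SerreLinearRepresentations1977]
* J. Neukirch, *Algebraic Number Theory* (1999), Ch. IV §1 (the absolute Galois group of a compositum).
  [NeukirchANT1999]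
* J. W. S. Cassels, A. Fröhlich (eds.), *Algebraic Number Theory* (1967), Ch. VII §4.2, §5.1 (Frobenius and
  the decomposition law in a quadratic extension). [CasselsFrohlichANT1967]
-/

noncomputable section

open scoped NumberField MatrixGroups Matrix IntermediateField
open NumberField IsDedekindDomain Field
open Literature.NumberTheory.Automorphic

namespace Literature.NumberTheory.GaloisRepresentations

/-! ## 1. The compositum `E' = E K'` of a totally complex quadratic `E/K` and a totally real `K'/K` -/

section Compositum

/-- **The compositum `E' = E K'` as a type.**  For a quadratic extension `E/K` of number fields with
`E` totally complex and a totally real number field `K'/K`, there is a number field `E'` with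
compatible algebra structures `K' → E'`, `E → E'`, `K → E'`, of degree `[E' : K'] = 2`, totally
complex, and generated over `K` by the images of `E` and `K'` (a compositum).  Construction:
`E' = K'(φ a)` inside an algebraic closure of `K'`, for a primitive element `a` of `E/K` and a
`K`-embedding `φ : E → \overline{K'}`; `[K'(φ a) : K'] ≤ 2`, and `≠ 1` because `E` (totally complex)
does not embed into the totally real `K'`. [folklore] -/
theorem exists_quadratic_compositum (K E K' : Type) [Field K] [NumberField K] [Field E] [NumberField E]
    [Field K'] [NumberField K'] [Algebra K E] [Algebra K K'] (hd : Module.finrank K E = 2)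
    (hE : IsTotallyComplex E) (hK' : IsTotallyReal K') :
    ∃ (E' : Type) (_ : Field E') (_ : NumberField E') (_ : Algebra K' E') (_ : Algebra E E')
      (_ : Algebra K E') (_ : IsScalarTower K K' E') (_ : IsScalarTower K E E'),
      Module.finrank K' E' = 2 ∧ IsTotallyComplex E' ∧
      (IsScalarTower.toAlgHom K E E').fieldRange ⊔ (IsScalarTower.toAlgHom K K' E').fieldRange = ⊤ := by
  classical
  haveI : FiniteDimensional K E := Module.finite_of_finrank_eq_succ hd
  -- the ambient algebraic closure of `K'`, as a `K`-algebra through `K → K'`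
  let L := AlgebraicClosure K'
  -- a primitive element of `E/K` and a `K`-embedding `E → L`
  obtain ⟨a, ha⟩ := Field.exists_primitive_element K E
  haveI : Algebra.IsAlgebraic K E := Algebra.IsAlgebraic.of_finite K E
  let φ : E →ₐ[K] L := IsAlgClosed.lift
  let b : L := φ a
  have hbint : IsIntegral K' b := IsIntegral.tower_top ((Algebra.IsIntegral.isIntegral (R := K) a).map φ)
  let E' : IntermediateField K' L := K'⟮b⟯
  haveI : FiniteDimensional K' E' := IntermediateField.adjoin.finiteDimensional hbint
  -- `φ(E) ⊆ E'`
  have hφmem : ∀ x : E, φ x ∈ E' := by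
    intro x
    have hx : x ∈ (⊤ : IntermediateField K E) := IntermediateField.mem_top
    rw [← ha] at hx
    have hmap : φ x ∈ (K⟮a⟯).map φ := ⟨x, hx, rfl⟩
    rw [IntermediateField.adjoin_map, Set.image_singleton] at hmap
    have hle : K⟮φ a⟯ ≤ (K'⟮b⟯).restrictScalars K :=
      IntermediateField.adjoin_le_iff.mpr (by
        rintro _ rfl
        exact IntermediateField.mem_adjoin_simple_self K' b)
    exact hle hmap
  let ψ : E →+* E' := φ.toRingHom.codRestrict E'.toSubalgebra.toSubring.toSubsemiring hφmem
  letI : Algebra E E' := ψ.toAlgebra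
  haveI : IsScalarTower K E E' := IsScalarTower.of_algebraMap_eq fun x => by
    apply Subtype.ext
    change algebraMap K L x = φ (algebraMap K E x)
    rw [AlgHom.commutes]
  -- degree `2`
  have hdeg_le : Module.finrank K' E' ≤ 2 := by
    rw [IntermediateField.adjoin.finrank hbint]
    have hmin : minpoly K' b ∣ (minpoly K a).map (algebraMap K K') := by
      apply minpoly.dvd
      rw [Polynomial.aeval_map_algebraMap, show b = φ a from rfl, Polynomial.aeval_algHom_apply,
        minpoly.aeval, map_zero]
    have hdeg : (minpoly K a).natDegree = 2 := by
      rw [← IntermediateField.adjoin.finrank (Algebra.IsIntegral.isIntegral a), ha,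
        IntermediateField.finrank_top', hd]
    calc (minpoly K' b).natDegree ≤ ((minpoly K a).map (algebraMap K K')).natDegree :=
          Polynomial.natDegree_le_of_dvd hmin ((Polynomial.Monic.map _ (minpoly.monic
            (Algebra.IsIntegral.isIntegral a))).ne_zero)
      _ = 2 := by rw [Polynomial.natDegree_map, hdeg]
  have hdeg_ne : Module.finrank K' E' ≠ 1 := by
    intro h1
    -- then `E' = K'` and `E` embeds into the totally real `K'`
    have hbot : (E' : IntermediateField K' L) = ⊥ := IntermediateField.finrank_eq_one_iff.mp h1
    have hbmem : b ∈ (⊥ : IntermediateField K' L) := hbot ▸ IntermediateField.mem_adjoin_simple_self K' b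
    rw [IntermediateField.mem_bot] at hbmem
    -- every element of `φ(E)` lies in the image of `K'`
    have hall : ∀ x : E, φ x ∈ Set.range (algebraMap K' L) := by
      intro x
      have := hφmem x
      rw [show (E' : IntermediateField K' L) = ⊥ from hbot, IntermediateField.mem_bot] at this
      exact this
    -- the embedding `E → K'`
    choose g hg using hall
    have hginj : Function.Injective (algebraMap K' L) := (algebraMap K' L).injective
    let θ : E →+* K' :=
      { toFun := g
        map_one' := hginj (by rw [hg, map_one, map_one])
        map_mul' := fun x y => hginj (by rw [hg, map_mul, map_mul, hg, hg])
        map_zero' := hginj (by rw [hg, map_zero, map_zero])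
        map_add' := fun x y => hginj (by rw [hg, map_add, map_add, hg, hg]) }
    -- a complex embedding of `K'` is real; composing gives a real embedding of `E`
    obtain ⟨σ⟩ : Nonempty (K' →+* ℂ) := inferInstance
    have hreal : ComplexEmbedding.IsReal (σ.comp θ) := by
      have hσ := hK'.complexEmbedding_isReal σ
      rw [ComplexEmbedding.isReal_iff] at hσ ⊢
      ext x
      exact RingHom.congr_fun hσ (θ x)
    exact hE.complexEmbedding_not_isReal _ hreal
  have hdeg2 : Module.finrank K' E' = 2 := by
    have hpos : 0 < Module.finrank K' E' := Module.finrank_pos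
    omega
  -- `E'` is a number field, totally complex
  haveI : CharZero E' := charZero_of_injective_algebraMap (algebraMap K' E').injective
  haveI : NumberField E' :=
    { to_charZero := inferInstance
      to_finiteDimensional := Module.Finite.trans K' E' }
  have htc : IsTotallyComplex E' := @isTotallyComplex_of_algebra E _ E' _ _ hE
  -- the compositum property
  have hcomp : (IsScalarTower.toAlgHom K E E').fieldRange ⊔
      (IsScalarTower.toAlgHom K K' E').fieldRange = ⊤ := by
    set T : IntermediateField K E' := (IsScalarTower.toAlgHom K E E').fieldRange ⊔
      (IsScalarTower.toAlgHom K K' E').fieldRange with hT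
    have hK'T : ∀ x : K', algebraMap K' E' x ∈ T := fun x =>
      (le_sup_right : (IsScalarTower.toAlgHom K K' E').fieldRange ≤ T) ⟨x, rfl⟩
    let T' : IntermediateField K' E' := T.toSubfield.toIntermediateField hK'T
    have hbT : (⟨b, IntermediateField.mem_adjoin_simple_self K' b⟩ : E') ∈ T' := by
      change (⟨b, _⟩ : E') ∈ T
      exact (le_sup_left : (IsScalarTower.toAlgHom K E E').fieldRange ≤ T) ⟨a, Subtype.ext rfl⟩
    have hT'top : T' = ⊤ := by
      have hadj : K'⟮(⟨b, IntermediateField.mem_adjoin_simple_self K' b⟩ : E')⟯ = ⊤ := by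
        apply IntermediateField.lift_injective E'
        rw [IntermediateField.lift_adjoin_simple, IntermediateField.lift_top]
      rw [eq_top_iff, ← hadj, IntermediateField.adjoin_simple_le_iff]
      exact hbT
    rw [eq_top_iff]
    intro x _
    have : x ∈ T' := hT'top ▸ IntermediateField.mem_top
    exact this
  exact ⟨E', inferInstance, inferInstance, inferInstance, inferInstance, inferInstance,
    inferInstance, inferInstance, hdeg2, htc, hcomp⟩

end Compositum

/-! ## 2. The quadratic character and the diamond -/

section QuadraticCharacter

variable (K E : Type) [Field K] [NumberField K] [Field E] [NumberField E] [Algebra K E]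
  (p : ℕ) [Fact p.Prime]

/-- **The quadratic character `η_{E/K} : Γ_K → Aˣ`** of a quadratic extension `E/K` of number
fields, with values in any Hausdorff-free topological ring `A` with `2 ≠ 0`: a continuous character which
is `1` exactly on the open index-two subgroup `res(Γ_E)` and `-1` off it (`signCharOfIndexTwo`;
continuous because its kernel `res(Γ_E)` is open). [folklore] -/
theorem exists_signChar_absGaloisRestrict (A : Type*) [CommRing A] [TopologicalSpace A] [IsTopologicalRing A]
    [NeZero (2 : A)] (hd : Module.finrank K E = 2) :
    ∃ η : absoluteGaloisGroup K →ₜ* Aˣ,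
      (∀ g : absoluteGaloisGroup K, g ∈ (absGaloisRestrict K E).range → η g = 1) ∧
        ∀ g : absoluteGaloisGroup K, g ∉ (absGaloisRestrict K E).range → η g = -1 := by
  obtain ⟨hopen, hindex⟩ := isOpen_range_absGaloisRestrict_and_index_eq_two K E hd
  refine ⟨⟨signCharOfIndexTwo (R := A) ((absGaloisRestrict K E).range) hindex, ?_⟩,
    fun g hg => signCharOfIndexTwo_apply_of_mem hindex hg,
    fun g hg => signCharOfIndexTwo_apply_of_not_mem hindex hg⟩
  refine Literature.NumberTheory.Automorphic.MonoidHom.continuous_of_isOpen_ker _ ?_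
  rw [ker_signCharOfIndexTwo]
  exact hopen

end QuadraticCharacter

section Diamond

variable {K E K' E' : Type} [Field K] [NumberField K] [Field E] [NumberField E] [Field K']
  [NumberField K'] [Field E'] [NumberField E'] [Algebra K E] [Algebra K K'] [Algebra K' E']
  [Algebra E E'] [Algebra K E'] [IsScalarTower K K' E'] [IsScalarTower K E E']

omit [NumberField E] in
/-- **The diamond `E' = E K'` in absolute Galois groups.**  If `E'` is generated over `K` by the
images of two Galois subextensions `E` and `K'`, then an element of `Γ_{K'}` comes from `Γ_{E'}` iff
its image in `Γ_K` comes from `Γ_E` (`Γ_{E'} = Γ_E ∩ Γ_{K'}` in `Γ_K`,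
`SorensenPatching.range_absGaloisRestrict_eq_inf_of_sup_eq_top`, together with the transitivity of
restriction up to an inner automorphism and the normality of the subgroups involved). [folklore] -/
theorem mem_range_absGaloisRestrict_iff_of_compositum [IsGalois K E] [IsGalois K K']
    (hcomp : (IsScalarTower.toAlgHom K E E').fieldRange ⊔
      (IsScalarTower.toAlgHom K K' E').fieldRange = ⊤)
    (g : absoluteGaloisGroup K') :
    g ∈ (absGaloisRestrict K' E').range ↔ absGaloisRestrict K K' g ∈ (absGaloisRestrict K E).range := by
  haveI : FiniteDimensional K K' := Module.Finite.of_restrictScalars_finite ℚ K K'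
  haveI : FiniteDimensional K E' := Module.Finite.of_restrictScalars_finite ℚ K E'
  haveI : FiniteDimensional K' E' := Module.Finite.of_restrictScalars_finite ℚ K' E'
  haveI : Algebra.IsAlgebraic K K' := Algebra.IsAlgebraic.of_finite K K'
  haveI : Algebra.IsAlgebraic K E' := Algebra.IsAlgebraic.of_finite K E'
  haveI : Algebra.IsAlgebraic K' E' := Algebra.IsAlgebraic.of_finite K' E'
  have hR := SorensenPatching.range_absGaloisRestrict_eq_inf_of_sup_eq_top (F := K) E K' E' hcomp
  obtain ⟨τ, hτ⟩ := SorensenPatching.exists_absGaloisRestrict_absGaloisRestrict_eq_conj K K' E'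
  haveI hnE : ((absGaloisRestrict K E).range).Normal := normal_range_absGaloisRestrict K E
  haveI hnK' : ((absGaloisRestrict K K').range).Normal := normal_range_absGaloisRestrict K K'
  haveI hnE' : ((absGaloisRestrict K E').range).Normal := by
    rw [hR]; infer_instance
  constructor
  · rintro ⟨h, rfl⟩
    change absGaloisRestrict K K' (absGaloisRestrict K' E' h) ∈ _
    rw [hτ]
    have hmem : absGaloisRestrict K E' h ∈ (absGaloisRestrict K E).range :=
      (show absGaloisRestrict K E' h ∈ (absGaloisRestrict K E).range ⊓ (absGaloisRestrict K K').range
        from hR ▸ ⟨h, rfl⟩).1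
    exact hnE.conj_mem _ hmem τ
  · intro hg
    have hmem : absGaloisRestrict K K' g ∈ (absGaloisRestrict K E').range := by
      rw [hR]; exact ⟨hg, ⟨g, rfl⟩⟩
    have hmem' : τ⁻¹ * absGaloisRestrict K K' g * τ⁻¹⁻¹ ∈ (absGaloisRestrict K E').range :=
      hnE'.conj_mem _ hmem τ⁻¹
    obtain ⟨h, hh⟩ := hmem'
    refine ⟨h, absGaloisRestrict_injective K K' ?_⟩
    change absGaloisRestrict K K' (absGaloisRestrict K' E' h) = _
    rw [hτ, show absGaloisRestrict K E' h = τ⁻¹ * absGaloisRestrict K K' g * τ⁻¹⁻¹ from hh]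
    group

/-- **At an inert place no Frobenius comes from `Γ_{E'}`**: for a quadratic extension `E'/K'`, a place
`v` of `K'` unramified in `E'` with a place `w ∣ v` of residue degree `2`, and an arithmetic Frobenius
`Φ` at a prime of `\bar ℤ` over `v`, `Φ ∉ res(Γ_{E'})` (otherwise every place over `v` would have
residue degree `1`, `exists_places_split_of_mem_range`). [folklore] -/
theorem not_mem_range_absGaloisRestrict_of_inert (h2 : Module.finrank K' E' = 2)
    {v : HeightOneSpectrum (𝓞 K')} (hunr : Algebra.IsUnramifiedIn (𝓞 E') v.asIdeal)
    {w : HeightOneSpectrum (𝓞 E')} (hw : w.asIdeal.under (𝓞 K') = v.asIdeal)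
    (hf : w.asIdeal.inertiaDeg (𝓞 K') = 2) {𝔓 : Ideal (absIntegers (𝓞 K') K')}
    (h𝔓 : 𝔓 ∈ v.primesAbove) {Φ : absoluteGaloisGroup K'} (hΦ : IsArithFrobAt (𝓞 K') Φ 𝔓) :
    Φ ∉ (absGaloisRestrict K' E').range := by
  intro hΦH
  haveI : FiniteDimensional K' E' := Module.finite_of_finrank_eq_succ h2
  haveI : Algebra.IsQuadraticExtension K' E' := ⟨h2⟩
  haveI : IsGalois K' E' := inferInstance
  have hprime : (Module.finrank K' E').Prime := by rw [h2]; exact Nat.prime_two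
  obtain ⟨-, hHi⟩ := isOpen_range_absGaloisRestrict_and_index K' E'
  haveI hHn : ((absGaloisRestrict K' E').range).Normal := normal_range_absGaloisRestrict K' E'
  obtain ⟨c, hc⟩ : ∃ c : absoluteGaloisGroup K', c ∉ (absGaloisRestrict K' E').range := by
    by_contra! hall
    have htop : (absGaloisRestrict K' E').range = ⊤ := eq_top_iff.mpr fun g _ => hall g
    rw [htop, Subgroup.index_top, h2] at hHi
    exact absurd hHi (by norm_num)
  obtain ⟨-, -, -, -, hf1, -, -⟩ :=
    exists_places_split_of_mem_range (F := K') (M := E') hprime hHn hHi hc hunr h𝔓 hΦ hΦH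
  have := hf1 w (HeightOneSpectrum.ext hw)
  omega

end Diamond

/-! ## 3. Index two; block sums; Schur -/

section IndexTwo

/-- **Index two: a stable subspace for the subgroup is at least half of the space.**  If `π` is an
irreducible representation of `G` on `V`, `φ : H → G` has image `N` of index `2`, and `U ≠ 0` is an
`N`-stable subspace, then `V = U + π(g) U` for `g ∉ N`, so `dim V ≤ 2 dim U` (the even-dimension half
of Clifford's theorem; same argument as `Representation.isIrreducible_comp_of_index_two`).
[cite: Clifford1937, Thm. 1] -/
theorem finrank_le_two_mul_of_index_two {k : Type*} [Field k] {G H : Type*} [Group G]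
    [Group H] {V : Type*} [AddCommGroup V] [Module k V] [FiniteDimensional k V]
    (π : Representation k G V) (hπ : π.IsIrreducible) (φ : H →* G) (hφ : φ.range.index = 2)
    {π' : Representation k H V} (hπ' : ∀ h : H, π' h = π (φ h))
    (W : Subrepresentation π') (hW : W ≠ ⊥) :
    Module.finrank k V ≤ 2 * Module.finrank k W.toSubmodule := by
  classical
  haveI := hπ
  set N : Subgroup G := φ.range with hNdef
  haveI hN : N.Normal := Subgroup.normal_of_index_eq_two hφ
  obtain ⟨g, hg⟩ : ∃ g : G, g ∉ N := by
    by_contra! h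
    have htop : N = ⊤ := eq_top_iff.mpr fun x _ => h x
    rw [htop, Subgroup.index_top] at hφ
    exact absurd hφ (by norm_num)
  have hmul : ∀ {a b : G}, a ∉ N → b ∉ N → a * b ∈ N := fun ha hb =>
    (Subgroup.mul_mem_iff_of_index_two hφ).mpr (iff_of_false ha hb)
  have hginv : g⁻¹ ∉ N := fun h => hg (by simpa using N.inv_mem h)
  have hcomp : ∀ (a b : G) (v : V), π a (π b v) = π (a * b) v := fun a b v => by
    rw [map_mul]; rfl
  set U : Submodule k V := W.toSubmodule with hUdef
  have hUb : U ≠ ⊥ := fun h => hW (Subrepresentation.toSubmodule_injective h)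
  have hNU : ∀ x ∈ N, ∀ v ∈ U, π x v ∈ U := by
    rintro _ ⟨h, rfl⟩ v hv
    have := W.apply_mem_toSubmodule h hv
    rwa [hπ'] at this
  set U' : Submodule k V := U.map (π g) with hU'def
  have hNU' : ∀ x ∈ N, ∀ v ∈ U', π x v ∈ U' := by
    intro x hx v hv
    obtain ⟨u, hu, rfl⟩ := Submodule.mem_map.mp hv
    rw [hcomp, show x * g = g * (g⁻¹ * x * g) by group, ← hcomp]
    exact Submodule.mem_map_of_mem (hNU _ (by simpa using hN.conj_mem x hx g⁻¹) u hu)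
  have hU_of_not : ∀ x ∉ N, ∀ v ∈ U, π x v ∈ U' := by
    intro x hx v hv
    rw [show x = g * (g⁻¹ * x) by group, ← hcomp]
    exact Submodule.mem_map_of_mem (hNU _ (hmul hginv hx) v hv)
  have hU'_of_not : ∀ x ∉ N, ∀ v ∈ U', π x v ∈ U := by
    intro x hx v hv
    obtain ⟨u, hu, rfl⟩ := Submodule.mem_map.mp hv
    rw [hcomp]
    exact hNU _ (hmul hx hg) u hu
  let S₁ : Subrepresentation π := ⟨U ⊔ U', fun x v hv => by
    obtain ⟨a, ha, b, hb, rfl⟩ := Submodule.mem_sup.mp hv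
    rw [map_add]
    by_cases hx : x ∈ N
    · exact Submodule.add_mem _ (Submodule.mem_sup_left (hNU x hx a ha))
        (Submodule.mem_sup_right (hNU' x hx b hb))
    · exact Submodule.add_mem _ (Submodule.mem_sup_right (hU_of_not x hx a ha))
        (Submodule.mem_sup_left (hU'_of_not x hx b hb))⟩
  have h₁ : U ⊔ U' = ⊤ := by
    rcases IsSimpleOrder.eq_bot_or_eq_top S₁ with h | h
    · exfalso
      have : U ⊔ U' = ⊥ := congrArg Subrepresentation.toSubmodule h
      exact hUb (le_bot_iff.mp (le_sup_left.trans this.le))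
    · exact congrArg Subrepresentation.toSubmodule h
  have hle := Submodule.finrank_add_le_finrank_add_finrank U U'
  rw [h₁, finrank_top] at hle
  have hU'le : Module.finrank k U' ≤ Module.finrank k U := Submodule.finrank_map_le _ _
  omega

end IndexTwo

section Framed

variable {G : Type*} [Group G] [TopologicalSpace G] {A : Type*} [Field A] [TopologicalSpace A]
  [IsTopologicalRing A] {m n : ℕ}

/-- A subrepresentation of `ρ` transported to the conjugate `P ρ P⁻¹` (by `v ↦ P v`), of the same
dimension. [folklore] -/
theorem exists_subrepresentation_conj (ρ : FramedRep G A n) (P : GL (Fin n) A)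
    (W : Subrepresentation ρ.toRepresentation) :
    ∃ W' : Subrepresentation (FramedRep.conj P ρ).toRepresentation,
      Module.finrank A W'.toSubmodule = Module.finrank A W.toSubmodule := by
  let L : (Fin n → A) →ₗ[A] (Fin n → A) := Matrix.mulVecLin (P : Matrix (Fin n) (Fin n) A)
  have hinj : Function.Injective L :=
    Matrix.mulVec_injective_iff_isUnit.mpr (Units.isUnit P)
  refine ⟨⟨W.toSubmodule.map L, fun g v hv => ?_⟩, (Submodule.equivMapOfInjective L hinj _).finrank_eq.symm⟩
  obtain ⟨u, hu, rfl⟩ := Submodule.mem_map.mp hv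
  rw [FramedRep.toRepresentation_apply_apply, FramedRep.conj_apply]
  change (((P * ρ g * P⁻¹ : GL (Fin n) A) : Matrix (Fin n) (Fin n) A)) *ᵥ
    ((P : Matrix (Fin n) (Fin n) A) *ᵥ u) ∈ W.toSubmodule.map L
  rw [Matrix.mulVec_mulVec, ← Units.val_mul, inv_mul_cancel_right, Units.val_mul,
    ← Matrix.mulVec_mulVec]
  exact Submodule.mem_map_of_mem (W.apply_mem_toSubmodule g hu)

omit [TopologicalSpace A] [IsTopologicalRing A] in
/-- `diag(M, N) · (u, v) = (M u, N v)`. [folklore] -/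
theorem blockSumRingHom_mulVec_append (M : Matrix (Fin m) (Fin m) A) (N : Matrix (Fin n) (Fin n) A)
    (u : Fin m → A) (v : Fin n → A) :
    blockSumRingHom m n A (M, N) *ᵥ Fin.append u v = Fin.append (M *ᵥ u) (N *ᵥ v) := by
  ext x
  refine Fin.addCases (fun i => ?_) (fun j => ?_) x
  · simp [Matrix.mulVec, dotProduct, Fin.sum_univ_add, Fin.append_left, Fin.append_right]
  · simp [Matrix.mulVec, dotProduct, Fin.sum_univ_add, Fin.append_left, Fin.append_right]

omit [IsTopologicalRing A] in
/-- A subrepresentation of the first summand of `ρ₁ ⊞ ρ₂` gives one of the block sum, of the same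
dimension. [folklore] -/
theorem exists_subrepresentation_blockSum_left (ρ₁ : FramedRep G A m) (ρ₂ : FramedRep G A n)
    (W : Subrepresentation ρ₁.toRepresentation) :
    ∃ W' : Subrepresentation (ρ₁.blockSum ρ₂).toRepresentation,
      Module.finrank A W'.toSubmodule = Module.finrank A W.toSubmodule := by
  -- `u ↦ (u, 0)`, linear and injective
  let L : (Fin m → A) →ₗ[A] (Fin (m + n) → A) :=
    { toFun := fun u => Fin.append u 0
      map_add' := fun u u' => by
        ext x; refine Fin.addCases (fun i => ?_) (fun j => ?_) x <;> simp [Fin.append_left, Fin.append_right]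
      map_smul' := fun c u => by
        ext x; refine Fin.addCases (fun i => ?_) (fun j => ?_) x <;> simp [Fin.append_left, Fin.append_right] }
  have hL : ∀ u, L u = Fin.append u 0 := fun _ => rfl
  have hinj : Function.Injective L := by
    intro u u' h
    ext i
    have := congrFun h (Fin.castAdd n i)
    simpa [hL, Fin.append_left] using this
  refine ⟨⟨W.toSubmodule.map L, fun g v hv => ?_⟩, (Submodule.equivMapOfInjective _ hinj _).finrank_eq.symm⟩
  obtain ⟨u, hu, rfl⟩ := Submodule.mem_map.mp hv
  rw [FramedRep.toRepresentation_apply_apply, FramedRep.coe_blockSum_apply, hL,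
    blockSumRingHom_mulVec_append, Matrix.mulVec_zero]
  exact Submodule.mem_map_of_mem (f := L) (W.apply_mem_toSubmodule g hu)

omit [IsTopologicalRing A] in
/-- The same for the second summand. [folklore] -/
theorem exists_subrepresentation_blockSum_right (ρ₁ : FramedRep G A m) (ρ₂ : FramedRep G A n)
    (W : Subrepresentation ρ₂.toRepresentation) :
    ∃ W' : Subrepresentation (ρ₁.blockSum ρ₂).toRepresentation,
      Module.finrank A W'.toSubmodule = Module.finrank A W.toSubmodule := by
  -- `v ↦ (0, v)`, linear and injective
  let L : (Fin n → A) →ₗ[A] (Fin (m + n) → A) :=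
    { toFun := fun v => Fin.append 0 v
      map_add' := fun v v' => by
        ext x; refine Fin.addCases (fun i => ?_) (fun j => ?_) x <;> simp [Fin.append_left, Fin.append_right]
      map_smul' := fun c v => by
        ext x; refine Fin.addCases (fun i => ?_) (fun j => ?_) x <;> simp [Fin.append_left, Fin.append_right] }
  have hL : ∀ v, L v = Fin.append 0 v := fun _ => rfl
  have hinj : Function.Injective L := by
    intro v v' h
    ext j
    have := congrFun h (Fin.natAdd m j)
    simpa [hL, Fin.append_right] using this
  refine ⟨⟨W.toSubmodule.map L, fun g v hv => ?_⟩, (Submodule.equivMapOfInjective _ hinj _).finrank_eq.symm⟩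
  obtain ⟨u, hu, rfl⟩ := Submodule.mem_map.mp hv
  rw [FramedRep.toRepresentation_apply_apply, FramedRep.coe_blockSum_apply, hL,
    blockSumRingHom_mulVec_append, Matrix.mulVec_zero]
  exact Submodule.mem_map_of_mem (f := L) (W.apply_mem_toSubmodule g hu)

omit [IsTopologicalRing A] in
/-- A reducible framed representation of positive rank has a non-zero proper subrepresentation.
[folklore] -/
theorem exists_subrepresentation_of_not_isIrreducible {ρ : FramedRep G A n} (hn : 0 < n)
    (h : ¬ ρ.IsIrreducible) :
    ∃ W : Subrepresentation ρ.toRepresentation, W ≠ ⊥ ∧ W ≠ ⊤ := by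
  by_contra! hall
  apply h
  haveI : Nontrivial (Subrepresentation ρ.toRepresentation) := by
    refine ⟨⟨⊥, ⊤, fun hbt => ?_⟩⟩
    have h' : (⊥ : Submodule A (Fin n → A)) = ⊤ := congrArg Subrepresentation.toSubmodule hbt
    have hmem : (Pi.single (⟨0, hn⟩ : Fin n) (1 : A) : Fin n → A) ∈ (⊥ : Submodule A (Fin n → A)) :=
      h' ▸ Submodule.mem_top
    rw [Submodule.mem_bot] at hmem
    have h1 := congrFun hmem ⟨0, hn⟩
    simp only [Pi.single_eq_same, Pi.zero_apply] at h1
    exact one_ne_zero h1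
  exact ⟨fun W => by
    by_cases hW : W = ⊥
    · exact Or.inl hW
    · exact Or.inr (hall W hW)⟩

omit [IsTopologicalRing A] in
/-- **Schur's lemma for framed representations**: a non-zero matrix intertwining an irreducible `U`
with `T` of the same rank (`T(g) X = X U(g)`) is invertible (its kernel is a proper `U`-stable
subspace, hence zero). [cite: SerreLinearRepresentations1977, §2.2 Prop. 4] -/
theorem isUnit_of_mul_eq_mul_of_isIrreducible {U T : FramedRep G A n} (hU : U.IsIrreducible)
    {X : Matrix (Fin n) (Fin n) A} (hX : X ≠ 0)
    (h : ∀ g : G, ((T g : GL (Fin n) A) : Matrix (Fin n) (Fin n) A) * X =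
      X * ((U g : GL (Fin n) A) : Matrix (Fin n) (Fin n) A)) :
    IsUnit X := by
  haveI := hU
  let f : Representation.IntertwiningMap U.toRepresentation T.toRepresentation :=
    LinearMap.intertwiningMap_of_isIntertwiningMap _ _ (Matrix.mulVecLin X) fun g v => by
      change X *ᵥ (((U g : GL (Fin n) A) : Matrix (Fin n) (Fin n) A) *ᵥ v) =
        ((T g : GL (Fin n) A) : Matrix (Fin n) (Fin n) A) *ᵥ (X *ᵥ v)
      rw [Matrix.mulVec_mulVec, Matrix.mulVec_mulVec, h g]
  rcases Representation.IsIrreducible.injective_or_eq_zero f with hinj | h0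
  · exact Matrix.mulVec_injective_iff_isUnit.mp hinj
  · exfalso
    apply hX
    have h1 : (f : (Fin n → A) → (Fin n → A)) = X.mulVec := rfl
    rw [h0] at h1
    ext i j
    have := congrFun (congrFun h1.symm (Pi.single j 1)) i
    simpa [Matrix.mulVec_single_one] using this

/-- **Matching an irreducible block of a block sum** (Krull–Schmidt for one irreducible summand).
If `T₀ ⊞ T₁ = S (U₀ ⊞ U₁) S⁻¹` with `U₀` irreducible, then `U₀` is conjugate to `T₀` or to `T₁`:
the first column block of `S` splits into `X₀, X₁` with `T_k X_k = X_k U₀`, not both zero since `S`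
is invertible, and a non-zero one is invertible by Schur's lemma.
[cite: SerreLinearRepresentations1977, §2.2 Prop. 4] -/
theorem exists_eq_conj_of_blockSum_eq_conj_blockSum (hn : 0 < n) (U₀ U₁ T₀ T₁ : FramedRep G A n)
    (S : GL (Fin (n + n)) A)
    (hS : FramedRep.blockSum T₀ T₁ = FramedRep.conj S (FramedRep.blockSum U₀ U₁))
    (hU : U₀.IsIrreducible) :
    (∃ X : GL (Fin n) A, T₀ = FramedRep.conj X U₀) ∨ (∃ X : GL (Fin n) A, T₁ = FramedRep.conj X U₀) := by
  -- `diag(T₀ g, T₁ g) S = S diag(U₀ g, U₁ g)`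
  have hmul : ∀ g : G,
      blockSumRingHom n n A (((T₀ g : GL (Fin n) A) : Matrix (Fin n) (Fin n) A),
          ((T₁ g : GL (Fin n) A) : Matrix (Fin n) (Fin n) A)) * (S : Matrix (Fin (n + n)) (Fin (n + n)) A) =
        (S : Matrix (Fin (n + n)) (Fin (n + n)) A) *
          blockSumRingHom n n A (((U₀ g : GL (Fin n) A) : Matrix (Fin n) (Fin n) A),
            ((U₁ g : GL (Fin n) A) : Matrix (Fin n) (Fin n) A)) := by
    intro g
    have e := congrArg (fun ρ : FramedRep G A (n + n) => (((ρ g) * S : GL (Fin (n + n)) A) :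
      Matrix (Fin (n + n)) (Fin (n + n)) A)) hS
    simp only [FramedRep.conj_apply, inv_mul_cancel_right, Units.val_mul,
      FramedRep.coe_blockSum_apply] at e
    exact e
  -- the blocks `X₀, X₁` of the first block column of `S`
  set X₀ : Matrix (Fin n) (Fin n) A := fun i j =>
    (S : Matrix (Fin (n + n)) (Fin (n + n)) A) (Fin.castAdd n i) (Fin.castAdd n j) with hX₀
  set X₁ : Matrix (Fin n) (Fin n) A := fun i j =>
    (S : Matrix (Fin (n + n)) (Fin (n + n)) A) (Fin.natAdd n i) (Fin.castAdd n j) with hX₁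
  have h0 : ∀ g : G, ((T₀ g : GL (Fin n) A) : Matrix (Fin n) (Fin n) A) * X₀ =
      X₀ * ((U₀ g : GL (Fin n) A) : Matrix (Fin n) (Fin n) A) := by
    intro g
    ext i j
    have e := congrFun (congrFun (hmul g) (Fin.castAdd n i)) (Fin.castAdd n j)
    rw [Matrix.mul_apply, Matrix.mul_apply, Fin.sum_univ_add, Fin.sum_univ_add] at e
    simp only [blockSumRingHom_apply_castAdd_castAdd, blockSumRingHom_apply_castAdd_natAdd,
      blockSumRingHom_apply_natAdd_castAdd, zero_mul, mul_zero, Finset.sum_const_zero, add_zero] at e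
    rw [Matrix.mul_apply, Matrix.mul_apply]
    exact e
  have h1 : ∀ g : G, ((T₁ g : GL (Fin n) A) : Matrix (Fin n) (Fin n) A) * X₁ =
      X₁ * ((U₀ g : GL (Fin n) A) : Matrix (Fin n) (Fin n) A) := by
    intro g
    ext i j
    have e := congrFun (congrFun (hmul g) (Fin.natAdd n i)) (Fin.castAdd n j)
    rw [Matrix.mul_apply, Matrix.mul_apply, Fin.sum_univ_add, Fin.sum_univ_add] at e
    simp only [blockSumRingHom_apply_natAdd_natAdd, blockSumRingHom_apply_natAdd_castAdd,
      blockSumRingHom_apply_castAdd_castAdd, zero_mul, mul_zero, Finset.sum_const_zero, add_zero,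
      zero_add] at e
    rw [Matrix.mul_apply, Matrix.mul_apply]
    exact e
  -- not both zero
  have hne : X₀ ≠ 0 ∨ X₁ ≠ 0 := by
    by_contra! hboth
    obtain ⟨h0', h1'⟩ := hboth
    have hcol : ∀ z : Fin (n + n), (S : Matrix (Fin (n + n)) (Fin (n + n)) A) z (Fin.castAdd n ⟨0, hn⟩) = 0 := by
      intro z
      refine Fin.addCases (fun i => ?_) (fun i => ?_) z
      · exact congrFun (congrFun h0' i) ⟨0, hn⟩
      · exact congrFun (congrFun h1' i) ⟨0, hn⟩
    have hdet : Matrix.det (S : Matrix (Fin (n + n)) (Fin (n + n)) A) = 0 :=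
      Matrix.det_eq_zero_of_column_eq_zero _ hcol
    have hunit : IsUnit (Matrix.det (S : Matrix (Fin (n + n)) (Fin (n + n)) A)) := by
      rw [← Matrix.GeneralLinearGroup.val_det_apply]; exact Units.isUnit _
    exact not_isUnit_zero (hdet ▸ hunit)
  -- Schur
  have key : ∀ {T : FramedRep G A n} {X : Matrix (Fin n) (Fin n) A}, X ≠ 0 →
      (∀ g, ((T g : GL (Fin n) A) : Matrix (Fin n) (Fin n) A) * X =
        X * ((U₀ g : GL (Fin n) A) : Matrix (Fin n) (Fin n) A)) →
      ∃ Y : GL (Fin n) A, T = FramedRep.conj Y U₀ := by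
    intro T X hX h
    obtain ⟨Y, hY⟩ := isUnit_of_mul_eq_mul_of_isIrreducible hU hX h
    refine ⟨Y, ContinuousMonoidHom.ext fun g => ?_⟩
    rw [FramedRep.conj_apply]
    have hTY : T g * Y = Y * U₀ g := Units.ext (by rw [Units.val_mul, Units.val_mul, hY]; exact h g)
    rw [← hTY, mul_inv_cancel_right]
  rcases hne with hX | hX
  · exact Or.inl (key hX h0)
  · exact Or.inr (key hX h1)

/-- The same for the second block: if `T₀ ⊞ T₁ = S (U₀ ⊞ U₁) S⁻¹` with `U₁` irreducible, then `U₁`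
is conjugate to `T₀` or to `T₁` (second block column of `S`).
[cite: SerreLinearRepresentations1977, §2.2 Prop. 4] -/
theorem exists_eq_conj_of_blockSum_eq_conj_blockSum' (hn : 0 < n) (U₀ U₁ T₀ T₁ : FramedRep G A n)
    (S : GL (Fin (n + n)) A)
    (hS : FramedRep.blockSum T₀ T₁ = FramedRep.conj S (FramedRep.blockSum U₀ U₁))
    (hU : U₁.IsIrreducible) :
    (∃ X : GL (Fin n) A, T₀ = FramedRep.conj X U₁) ∨ (∃ X : GL (Fin n) A, T₁ = FramedRep.conj X U₁) := by
  have hmul : ∀ g : G,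
      blockSumRingHom n n A (((T₀ g : GL (Fin n) A) : Matrix (Fin n) (Fin n) A),
          ((T₁ g : GL (Fin n) A) : Matrix (Fin n) (Fin n) A)) * (S : Matrix (Fin (n + n)) (Fin (n + n)) A) =
        (S : Matrix (Fin (n + n)) (Fin (n + n)) A) *
          blockSumRingHom n n A (((U₀ g : GL (Fin n) A) : Matrix (Fin n) (Fin n) A),
            ((U₁ g : GL (Fin n) A) : Matrix (Fin n) (Fin n) A)) := by
    intro g
    have e := congrArg (fun ρ : FramedRep G A (n + n) => (((ρ g) * S : GL (Fin (n + n)) A) :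
      Matrix (Fin (n + n)) (Fin (n + n)) A)) hS
    simp only [FramedRep.conj_apply, inv_mul_cancel_right, Units.val_mul,
      FramedRep.coe_blockSum_apply] at e
    exact e
  set X₀ : Matrix (Fin n) (Fin n) A := fun i j =>
    (S : Matrix (Fin (n + n)) (Fin (n + n)) A) (Fin.castAdd n i) (Fin.natAdd n j) with hX₀
  set X₁ : Matrix (Fin n) (Fin n) A := fun i j =>
    (S : Matrix (Fin (n + n)) (Fin (n + n)) A) (Fin.natAdd n i) (Fin.natAdd n j) with hX₁
  have h0 : ∀ g : G, ((T₀ g : GL (Fin n) A) : Matrix (Fin n) (Fin n) A) * X₀ =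
      X₀ * ((U₁ g : GL (Fin n) A) : Matrix (Fin n) (Fin n) A) := by
    intro g
    ext i j
    have e := congrFun (congrFun (hmul g) (Fin.castAdd n i)) (Fin.natAdd n j)
    rw [Matrix.mul_apply, Matrix.mul_apply, Fin.sum_univ_add, Fin.sum_univ_add] at e
    simp only [blockSumRingHom_apply_castAdd_castAdd, blockSumRingHom_apply_castAdd_natAdd,
      blockSumRingHom_apply_natAdd_natAdd, zero_mul, mul_zero, Finset.sum_const_zero, add_zero,
      zero_add] at e
    rw [Matrix.mul_apply, Matrix.mul_apply]
    exact e
  have h1 : ∀ g : G, ((T₁ g : GL (Fin n) A) : Matrix (Fin n) (Fin n) A) * X₁ =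
      X₁ * ((U₁ g : GL (Fin n) A) : Matrix (Fin n) (Fin n) A) := by
    intro g
    ext i j
    have e := congrFun (congrFun (hmul g) (Fin.natAdd n i)) (Fin.natAdd n j)
    rw [Matrix.mul_apply, Matrix.mul_apply, Fin.sum_univ_add, Fin.sum_univ_add] at e
    simp only [blockSumRingHom_apply_natAdd_natAdd, blockSumRingHom_apply_castAdd_natAdd,
      blockSumRingHom_apply_natAdd_castAdd, zero_mul, mul_zero, Finset.sum_const_zero, zero_add] at e
    rw [Matrix.mul_apply, Matrix.mul_apply]
    exact e
  have hne : X₀ ≠ 0 ∨ X₁ ≠ 0 := by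
    by_contra! hboth
    obtain ⟨h0', h1'⟩ := hboth
    have hcol : ∀ z : Fin (n + n), (S : Matrix (Fin (n + n)) (Fin (n + n)) A) z (Fin.natAdd n ⟨0, hn⟩) = 0 := by
      intro z
      refine Fin.addCases (fun i => ?_) (fun i => ?_) z
      · exact congrFun (congrFun h0' i) ⟨0, hn⟩
      · exact congrFun (congrFun h1' i) ⟨0, hn⟩
    have hdet : Matrix.det (S : Matrix (Fin (n + n)) (Fin (n + n)) A) = 0 :=
      Matrix.det_eq_zero_of_column_eq_zero _ hcol
    have hunit : IsUnit (Matrix.det (S : Matrix (Fin (n + n)) (Fin (n + n)) A)) := by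
      rw [← Matrix.GeneralLinearGroup.val_det_apply]; exact Units.isUnit _
    exact not_isUnit_zero (hdet ▸ hunit)
  have key : ∀ {T : FramedRep G A n} {X : Matrix (Fin n) (Fin n) A}, X ≠ 0 →
      (∀ g, ((T g : GL (Fin n) A) : Matrix (Fin n) (Fin n) A) * X =
        X * ((U₁ g : GL (Fin n) A) : Matrix (Fin n) (Fin n) A)) →
      ∃ Y : GL (Fin n) A, T = FramedRep.conj Y U₁ := by
    intro T X hX h
    obtain ⟨Y, hY⟩ := isUnit_of_mul_eq_mul_of_isIrreducible hU hX h
    refine ⟨Y, ContinuousMonoidHom.ext fun g => ?_⟩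
    rw [FramedRep.conj_apply]
    have hTY : T g * Y = Y * U₁ g := Units.ext (by rw [Units.val_mul, Units.val_mul, hY]; exact h g)
    rw [← hTY, mul_inv_cancel_right]
  rcases hne with hX | hX
  · exact Or.inl (key hX h0)
  · exact Or.inr (key hX h1)

end Framed

/-! ## 4. `((Ind_E^K W)|Γ_E)|Γ_{E'}` as a block sum -/

section Blocks

variable {A : Type*} [CommRing A]

/-- The block-diagonal `2 × 2`-block matrix in the `finProdFinEquiv` frame is the block sum in the
`finSumFinEquiv` frame (same labelling of `Fin 4`). [folklore] -/
theorem reindex_comp_diagonal_eq_blockSumRingHom (f : Fin 2 → Matrix (Fin 2) (Fin 2) A) :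
    Matrix.reindex finProdFinEquiv finProdFinEquiv
      (Matrix.comp (Fin 2) (Fin 2) (Fin 2) (Fin 2) A (Matrix.diagonal f)) =
      blockSumRingHom 2 2 A (f 0, f 1) := by
  ext x y
  simp only [Matrix.reindex_apply, Matrix.submatrix_apply, Matrix.comp_apply, blockSumRingHom_apply,
    Matrix.fromBlocks, finProdFinEquiv_symm_apply, Matrix.of_apply]
  fin_cases x <;> fin_cases y <;> rfl

variable {K E E' : Type} [Field K] [NumberField K] [Field E] [NumberField E] [Field E']
  [NumberField E'] [Algebra K E] [Algebra E E'] [IsGalois K E] [TopologicalSpace A]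
  [IsTopologicalRing A]

omit [NumberField E'] [IsTopologicalRing A] in
/-- **`((Ind_E^K W)|Γ_E)|Γ_{E'} = W^{r₀⁻¹}|Γ_{E'} ⊞ W^{r₁⁻¹}|Γ_{E'}`** for a quadratic Galois `E/K`,
`W` of rank `2` and the transversal `r₀, r₁` of `induce` (`induce_restrictField_apply_coe`).
[cite: SerreLinearRepresentations1977, §7.3 Prop. 22] -/
theorem induce_restrictField_restrictField_eq_blockSum (hd : Module.finrank K E = 2)
    (W : FramedGaloisRep E A 2) :
    ((W.induce K hd).restrictField E).restrictField E' =
      FramedRep.blockSum ((W.outerConj (absGaloisCosetRep K E hd 0)⁻¹).restrictField E')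
        ((W.outerConj (absGaloisCosetRep K E hd 1)⁻¹).restrictField E') := by
  haveI : FiniteDimensional K E := Module.finite_of_finrank_eq_succ hd
  refine ContinuousMonoidHom.ext fun g => Units.ext ?_
  rw [FramedGaloisRep.restrictField_apply, FramedGaloisRep.induce_restrictField_apply_coe,
    FramedRep.coe_blockSum_apply, reindex_comp_diagonal_eq_blockSumRingHom]
  rfl

/-- One of the two coset representatives lies in `res(Γ_E)`. [folklore] -/
theorem exists_absGaloisCosetRep_mem_range (hd : Module.finrank K E = 2) :
    ∃ i : Fin 2, absGaloisCosetRep K E hd i ∈ (absGaloisRestrict K E).range := by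
  haveI : FiniteDimensional K E := Module.finite_of_finrank_eq_succ hd
  obtain ⟨i, hi⟩ := (absGaloisCosetRep_bijective K E hd).2
    ((1 : absoluteGaloisGroup K) : absoluteGaloisGroup K ⧸ (absGaloisRestrict K E).range)
  have hi' := QuotientGroup.eq.mp hi
  rw [mul_one, inv_mem_iff] at hi'
  exact ⟨i, hi'⟩

omit [NumberField K] [NumberField E'] in
/-- For `τ ∈ res(Γ_E)` the conjugate block is a change of frame of `W|Γ_{E'}`:
`W^{(res σ₀)⁻¹}|Γ_{E'} = W(σ₀⁻¹) W|Γ_{E'} W(σ₀⁻¹)⁻¹`. [folklore] -/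
theorem outerConj_inv_restrictField_eq_conj (W : FramedGaloisRep E A 2) (σ₀ : absoluteGaloisGroup E) :
    (W.outerConj (absGaloisRestrict K E σ₀)⁻¹).restrictField E' =
      FramedRep.conj (W σ₀⁻¹) (W.restrictField E') := by
  rw [← map_inv, FramedGaloisRep.outerConj_absGaloisRestrict]
  rfl

end Blocks

end Literature.NumberTheory.GaloisRepresentations

end
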